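import Summits.BirchSwinnertonDyer.BirchSwinnertonDyer.Theses.LeadingTerm
import Summits.BirchSwinnertonDyer.BirchSwinnertonDyer.Theorems.PAdicOrderV2PadicBSDrankNoExcessOfMainConjecture
import Literature.NumberTheory.EllipticCurves.CyclotomicIwasawaMainTheoremIrreducible
import Literature.NumberTheory.EllipticCurves.ModPIrreducibleCofinite
import Literature.NumberTheory.EllipticCurves.PAdicBSD

/-!
# BirchSwinnertonDyer / LeadingTerm — crux `PinchPrime` (stmt-BirchSwinnertonDyer-16218),
# line `SketchIdeator2`, stub `stub_cofiniteIMC` (GLUE)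

Registered stub of the lead skeleton `Cruxes/PinchPrime` (line `SketchIdeator2`, card
`first-layer-stability-sharp-pinch`): the cyclotomic main conjecture, COFINITELY in `p`, read as
an ORDER identity. For an elliptic curve `E/ℚ` (globally minimal `W`) there is a finite set `B`
of primes such that for every good ordinary `p ≥ 5`, `p ∉ B`, every cyclotomic datum
`(κ, γ)` (`κ` the cyclotomic `ℤ_p`-extension, `γ` a topological generator matching the
cyclotomic variable `T`), every Iwasawa datum `D` for `X = X(E/ℚ_∞)` with `char_Λ X = (f_E)` and
the newform `f` of `E`, one has `ord_{T=0} L_p(f, α_p, T) = ord_{T=0} f_E`.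

The deep input is the HYPOTHESIS `burungale_castella_skinner_charIdeal_eq_padicLFunction`
(Burungale–Castella–Skinner, IMRN 2025, Thm. 1.1.2 (a): for `p ≥ 5` good ordinary with `E[p]`
irreducible, `char_Λ X = (g)` with `ι g = p^k · L_p(f, α_p, T)` in `ℚ_p⟦T⟧`). Its only hypothesis
not among the stub's binders, irreducibility of `E[p]`, holds for all primes `p > N₀`
(`WeierstrassCurve.exists_forall_hasIrreducibleModPGaloisRep_of_lt`, Silverman *AEC* Cor. IX.6.3,
PROVED in the tree), whence `B := {0, …, N₀}`. The order algebra: `(g) = (f_E)` in the domain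
`Λ = ℤ_p⟦T⟧` makes `g` and `f_E` associated, so `ord f_E = ord g` (`PowerSeries.order_mul`,
units have order `0`); `ord (ι g) = ord g` (`Theorems.order_iwasawaToPowerSeries`); and
`ord (p^k · L_p) = ord L_p` (`C (p^k)` is a unit of `ℚ_p⟦T⟧`).
-/

noncomputable section

set_option linter.dupNamespace false

namespace Summit.BirchSwinnertonDyer.BirchSwinnertonDyer.Cruxes.PinchPrime.FirstLayerStability

open scoped MatrixGroups ModularForm
open CongruenceSubgroup Literature.NumberTheory.EllipticCurves
  Literature.NumberTheory.EllipticCurves.ModularForms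
open Summit.BirchSwinnertonDyer.BirchSwinnertonDyer.Theses

/-- **The cyclotomic main conjecture cofinitely in `p`, as an order identity** (stub
`stub_cofiniteIMC` of crux `PinchPrime`, line `SketchIdeator2`). Assume
`burungale_castella_skinner_charIdeal_eq_padicLFunction` (Burungale–Castella–Skinner 2025,
Thm. 1.1.2 (a)). Then for every elliptic `E/ℚ` (globally minimal `W`) there is a finite set `B` of
naturals such that for every prime `p ∉ B` with `p ≥ 5` of good ordinary reduction, every
cyclotomic `ℤ_p`-extension `κ` with topological generator `γ` matching the cyclotomic variable,
every Iwasawa datum `D` (with `X = D.X` finitely generated) whose characteristic ideal is `(f_E)`,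
and every newform `f` of `E`: `ord_{T=0} L_p(f, α_p, T) = ord_{T=0} f_E`. Take `B = {0, …, N₀}`
with `E[p]` irreducible for all primes `p > N₀`
(`WeierstrassCurve.exists_forall_hasIrreducibleModPGaloisRep_of_lt`); BCS gives `char X = (g)`,
`ι g = p^k L_p`; then `ord L_p = ord (p^k L_p) = ord (ι g) = ord g = ord f_E`, the last step because
`(g) = (f_E)` in the domain `Λ` forces `f_E = g · u` with `u ∈ Λˣ`.
[cite: BurungaleCastellaSkinner2025, Thm. 1.1.2 (a)] -/
theorem stub_cofiniteIMC :
    burungale_castella_skinner_charIdeal_eq_padicLFunction →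
    ∀ (W : WeierstrassCurve ℚ) [W.IsElliptic] [W.IsGloballyMinimal],
      ∃ B : Finset ℕ, ∀ p ∉ B, ∀ [Fact p.Prime], 5 ≤ p → IsOrdinaryAt W p →
        ∀ (κ : ZpExtension ℚ p) (γ : Field.absoluteGaloisGroup ℚ),
          κ.IsCyclotomic → κ.IsTopGenerator γ → IsCyclotomicVariable p γ →
        ∀ (D : W.SelmerDualData κ γ) [Module.Finite (IwasawaAlgebra p) D.X] (fE : IwasawaAlgebra p),
          D.charIdeal = Ideal.span {fE} →
        ∀ {N : ℕ} [NeZero N] (f : CuspForm (Gamma0 N) 2), IsNewformOf W f →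
          (padicLFunction f (unitRoot W p : ℚ_[p])).order = fE.order := by
  intro hBCS W _ _
  -- the finitely many primes with `E[p]` reducible
  obtain ⟨N₀, hN₀⟩ := W.exists_forall_hasIrreducibleModPGaloisRep_of_lt
  refine ⟨Finset.range (N₀ + 1), ?_⟩
  intro p hpB _ h5 hord κ γ hκ hγ hγ' D _ fE hfE N _ f hf
  have hNp : N₀ < p := by
    rw [Finset.mem_range, not_lt] at hpB
    omega
  have hirr : W.HasIrreducibleModPGaloisRep p := hN₀ p hNp Fact.out
  -- the main conjecture in `Λ ⊗ ℚ_p` (BCS): `char X = (g)`, `ι g = p^k · L_p`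
  obtain ⟨-, g, k, hg, hιg⟩ := hBCS W p κ γ f h5 hord.1 hord.2 hirr hκ hγ hγ' hf D
  -- `(g) = (fE)` in the domain `Λ`: `fE = g * u`, `u` a unit, so `ord fE = ord g`
  have hassoc : Associated g fE :=
    Ideal.span_singleton_eq_span_singleton.mp (hg.symm.trans hfE)
  obtain ⟨u, hu⟩ := hassoc
  have hfg : fE.order = g.order := by
    rw [← hu, PowerSeries.order_mul, PowerSeries.order_zero_of_unit u.isUnit, add_zero]
  -- `ord (ι g) = ord (p^k · L_p) = ord L_p`
  have hpk : IsUnit (PowerSeries.C ((p : ℚ_[p]) ^ k)) := by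
    refine IsUnit.map PowerSeries.C (IsUnit.mk0 _ (zpow_ne_zero k ?_))
    exact_mod_cast (Fact.out : p.Prime).ne_zero
  have h2 : (iwasawaToPowerSeries p g).order =
      (padicLFunction f (unitRoot W p : ℚ_[p])).order := by
    rw [hιg, PowerSeries.order_mul, PowerSeries.order_zero_of_unit hpk, zero_add]
  rw [← h2, Summit.BirchSwinnertonDyer.BirchSwinnertonDyer.Theorems.order_iwasawaToPowerSeries, hfg]

end Summit.BirchSwinnertonDyer.BirchSwinnertonDyer.Cruxes.PinchPrime.FirstLayerStability

end
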